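import Literature.AlgebraicGeometry.Resolution.HironakaTauBaseChange
import Literature.AlgebraicGeometry.Resolution.HironakaTauScheme
import Literature.AlgebraicGeometry.Resolution.BlowupOffCentre
import Literature.AlgebraicGeometry.Resolution.BlowupsFlatBaseChange
import Literature.AlgebraicGeometry.Resolution.StalkIdealLemmas
import Literature.AlgebraicGeometry.Resolution.RegularSystemOfParameters
import HarnessLib

/-!
# `τ` is invariant under isomorphisms of local rings; `τ` does not change off the centre of a blowing up

Topic: `Literature/AlgebraicGeometry/Resolution`. [CoP1] = Cossart–Piltant, J. Algebra 320 (2008)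
1051–1082, proof of Prop. 4.2: `τ(x) := dim_{k(x)} T_x` depends only on the local ring `𝒪_{X,x}`
and the ideal `J_x`; in the proof of Prop. 4.4 the invariants of the points of `Σ` AWAY from the
centre of a blowing up are unchanged (the blowing up is an isomorphism there). PROVED here
(folklore bookkeeping the tree lacked; `τ` under a change of regular system of parameters is
`InitialFormsChangeOfParameters.lean`, under a homomorphism of coefficient fields
`HironakaTauBaseChange.lean`):

* `initialForms_comp_ringEquiv` — for a ring isomorphism `e : R ≅ R′` of local rings,
  `cl_μ(e J)` computed in `e ∘ c` is the image of `cl_μ(J)` computed in `c` under the induced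
  isomorphism of residue fields;
* `hironakaTauAt_comp_ringEquiv` — **`τ(e ∘ c, e J, μ) = τ(c, J, μ)`**;
* `stalkTau_eq_of_isIso_stalkMap` — **scheme level: if `π` induces an isomorphism
  `𝒪_{X,π x′} ≅ 𝒪_{X′,x′}` carrying `J_{π x′}` onto `J′_{x′}`, then `τ_{x′}(J′, μ) = τ_{π x′}(J, μ)`**;
* `IsBlowup.stalkTau_controlledTransform_of_not_mem` — **off the centre of a blowing up, the
  weak (controlled) transform has the same `τ` as `J` downstairs.**

## Sources

* V. Cossart, O. Piltant, J. Algebra 320 (2008) 1051–1082, proof of Prop. 4.2 (`τ(x)`), proof of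
  Prop. 4.4 p. 9–10. [CossartPiltant2008]
* U. Görtz, T. Wedhorn, *Algebraic Geometry I*, 2nd ed. (2020), Prop. 13.91 (3). [GortzWedhorn2020]
-/

noncomputable section

open CategoryTheory CategoryTheory.Limits AlgebraicGeometry TopologicalSpace IsLocalRing MvPolynomial

namespace Literature.AlgebraicGeometry.Resolution

universe u

/-! ## Ring level: isomorphisms of local rings -/

section Ring

variable {R R' : Type u} [CommRing R] [CommRing R'] [IsLocalRing R] [IsLocalRing R']
  (e : R ≃+* R') {d : ℕ} (c : Fin d → R)

omit [IsLocalRing R] [IsLocalRing R'] in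
/-- Evaluating the transported form at the transported parameters. [folklore] -/
private theorem eval_comp_map_ringEquiv (F : MvPolynomial (Fin d) R) :
    MvPolynomial.eval ((e : R → R') ∘ c) (MvPolynomial.map (e : R →+* R') F) =
      e (MvPolynomial.eval c F) := by
  have h := MvPolynomial.eval₂_comp_left (e : R →+* R') (RingHom.id R) c F
  simp only [RingHom.comp_id, RingEquiv.coe_toRingHom] at h
  rw [MvPolynomial.eval_map]
  exact h.symm

/-- Reducing the transported form modulo `𝔪′`. [folklore] -/
private theorem map_residue_map_ringEquiv (F : MvPolynomial (Fin d) R) :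
    MvPolynomial.map (residue R') (MvPolynomial.map (e : R →+* R') F) =
      MvPolynomial.map (ResidueField.map (e : R →+* R')) (MvPolynomial.map (residue R) F) := by
  rw [MvPolynomial.map_map, MvPolynomial.map_map, ResidueField.map_comp_residue]

omit [IsLocalRing R] [IsLocalRing R'] in
/-- `e⁻¹_* (e_* F) = F`. [folklore] -/
private theorem map_symm_map (F : MvPolynomial (Fin d) R) :
    MvPolynomial.map (e.symm : R' →+* R) (MvPolynomial.map (e : R →+* R') F) = F := by
  rw [MvPolynomial.map_map, show (e.symm : R' →+* R).comp (e : R →+* R') = RingHom.id R from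
    RingHom.ext fun a => e.symm_apply_apply a, MvPolynomial.map_id]

omit [IsLocalRing R] [IsLocalRing R'] in
/-- `e_* (e⁻¹_* F′) = F′`. [folklore] -/
private theorem map_map_symm (F' : MvPolynomial (Fin d) R') :
    MvPolynomial.map (e : R →+* R') (MvPolynomial.map (e.symm : R' →+* R) F') = F' := by
  rw [MvPolynomial.map_map, show (e : R →+* R').comp (e.symm : R' →+* R) = RingHom.id R' from
    RingHom.ext fun a => e.apply_symm_apply a, MvPolynomial.map_id]

/-- **Initial forms along an isomorphism of local rings**: for `e : R ≅ R′`, the space `cl_μ(e J)`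
computed in the parameters `e ∘ c` is the image of `cl_μ(J)` (computed in `c`) under the induced
isomorphism `k ≅ k′` of residue fields (`cl_μ(J) ⊆ k(x)[Y]` is an invariant of the local ring and
the ideal). [cite: CossartPiltant2008, proof of Prop. 4.2] -/
theorem initialForms_comp_ringEquiv (J : Ideal R) (μ : ℕ) :
    (initialForms ((e : R → R') ∘ c) (J.map (e : R →+* R')) μ :
        Set (MvPolynomial (Fin d) (ResidueField R'))) =
      MvPolynomial.map (ResidueField.map (e : R →+* R')) ''
        (initialForms c J μ : Set (MvPolynomial (Fin d) (ResidueField R))) := by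
  ext G'
  constructor
  · rintro ⟨F', hF', hFJ', rfl⟩
    -- pull the form back along `e`
    set F := MvPolynomial.map (e.symm : R' →+* R) F' with hFdef
    have hF'eq : F' = MvPolynomial.map (e : R →+* R') F := by rw [hFdef, map_map_symm]
    refine ⟨MvPolynomial.map (residue R) F, ⟨F, ?_, ?_, rfl⟩, ?_⟩
    · rw [hFdef]; exact hF'.map _
    · rw [hF'eq, eval_comp_map_ringEquiv] at hFJ'
      obtain ⟨y, hy, hye⟩ := (Ideal.mem_map_of_equiv e _).mp hFJ'
      exact e.injective hye ▸ hy
    · rw [hF'eq]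
      exact (map_residue_map_ringEquiv e F).symm
  · rintro ⟨_, ⟨F, hF, hFJ, rfl⟩, rfl⟩
    refine ⟨MvPolynomial.map (e : R →+* R') F, hF.map _, ?_, ?_⟩
    · rw [eval_comp_map_ringEquiv]
      exact Ideal.mem_map_of_mem _ hFJ
    · rw [map_residue_map_ringEquiv]

/-- **`τ` is invariant under isomorphisms of local rings**: `τ(e ∘ c, e J, μ) = τ(c, J, μ)`
(initial forms correspond under the residue-field isomorphism, and `τ` is invariant under an
isomorphism of coefficient fields, `hironakaTau_image_map_eq`).
[cite: CossartPiltant2008, proof of Prop. 4.2] -/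
theorem hironakaTauAt_comp_ringEquiv (J : Ideal R) (μ : ℕ) :
    hironakaTauAt ((e : R → R') ∘ c) (J.map (e : R →+* R')) μ = hironakaTauAt c J μ := by
  rw [hironakaTauAt, hironakaTauAt, initialForms_comp_ringEquiv]
  have h := hironakaTau_image_map_eq (ResidueField.mapEquiv e)
    (initialForms c J μ : Set (MvPolynomial (Fin d) (ResidueField R)))
  exact h

end Ring

/-! ## Scheme level: isomorphic local rings, and points off the centre of a blowing up -/

section Scheme

variable {X X' : Scheme.{u}} (π : X' ⟶ X)

set_option maxHeartbeats 400000 in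
/-- **`τ` at points with isomorphic local data.** If `π : X′ → X` induces an isomorphism
`𝒪_{X,π x′} ≅ 𝒪_{X′,x′}` (e.g. `π` is an isomorphism near `x′`) carrying the stalk `J_{π x′}` onto
`J′_{x′}`, then `τ_{x′}(J′, μ) = τ_{π x′}(J, μ)`. [cite: CossartPiltant2008, proof of Prop. 4.2] -/
theorem stalkTau_eq_of_isIso_stalkMap (x' : X') [IsIso (π.stalkMap x')]
    [IsRegularLocalRing (X.presheaf.stalk (π x'))] [IsRegularLocalRing (X'.presheaf.stalk x')]
    (J : X.IdealSheafData) (J' : X'.IdealSheafData)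
    (hJ : stalkIdeal J' x' = (stalkIdeal J (π x')).map (π.stalkMap x').hom) (μ : ℕ) :
    stalkTau J' x' μ = stalkTau J (π x') μ := by
  set e : X.presheaf.stalk (π x') ≃+* X'.presheaf.stalk x' :=
    (asIso (π.stalkMap x')).commRingCatIsoToRingEquiv with he
  have hehom : (e : X.presheaf.stalk (π x') →+* X'.presheaf.stalk x') = (π.stalkMap x').hom := rfl
  obtain ⟨c, hc⟩ := exists_regularSystemOfParameters (R := X.presheaf.stalk (π x'))
  -- the transported regular system of parameters
  have hc' : Ideal.span (Set.range ((e : _ → _) ∘ c)) = maximalIdeal (X'.presheaf.stalk x') := by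
    rw [Set.range_comp, ← Ideal.map_span, hc, map_ringEquiv_maximalIdeal]
  have hd' : (maximalIdeal (X'.presheaf.stalk x')).spanFinrank =
      (maximalIdeal (X.presheaf.stalk (π x'))).spanFinrank := by
    rw [← map_ringEquiv_maximalIdeal e, Ideal.spanFinrank_map_eq_of_ringEquiv]
  rw [stalkTau_eq J' x' μ hd' _ hc', stalkTau_eq J (π x') μ rfl c hc, hJ, ← hehom]
  exact hironakaTauAt_comp_ringEquiv e c (stalkIdeal J (π x')) μ

/-- **`τ` does not change off the centre of a blowing up**: for the blowing up `π` of `X` along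
`C` and `x′` with `π x′ ∉ V(C)`, the controlled (weak) transform `J′ = (π^*J : 𝓘(E)^b)` has
`τ_{x′}(J′, μ) = τ_{π x′}(J, μ)` (`π` is an isomorphism over `X ∖ V(C)`, and `J′ = π^*J` there).
[cite: CossartPiltant2008, proof of Prop. 4.4, p. 9–10] -/
theorem IsBlowup.stalkTau_controlledTransform_of_not_mem {C : X.IdealSheafData} {π}
    (hπ : IsBlowup π C) (J : X.IdealSheafData) (b μ : ℕ) {x' : X'}
    (hx : π x' ∉ (C.support : Set X)) [IsRegularLocalRing (X.presheaf.stalk (π x'))]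
    [IsRegularLocalRing (X'.presheaf.stalk x')] :
    stalkTau (controlledTransform π C J b) x' μ = stalkTau J (π x') μ := by
  set W : X.Opens := ⟨(C.support : Set X)ᶜ, C.support.isClosed.isOpen_compl⟩ with hW
  haveI : IsIso (π ∣_ W) := hπ.isIso_compl
  haveI : IsIso (π.stalkMap x') := isIso_stalkMap_of_isIso_morphismRestrict π W x' hx
  refine stalkTau_eq_of_isIso_stalkMap π x' J _ ?_ μ
  rw [hπ.stalkIdeal_controlledTransform_of_not_mem J b hx, stalkIdeal_comap_eq_map_stalkMap]

end Scheme

end Literature.AlgebraicGeometry.Resolution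

end
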